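import Summits.QuantumFields.QCD.Theorems.ExtinctionBuildsQCD.Negative.WithoutTightCollapse

/-!
# Negative lemmas for the crux `TipPricing` (item stmt-QuantumFields-8967): logical shape, and the
crux with TIGHT deleted from its consequent is trivially true (hypotheses unused)

Route `SpectralDefectExtinction` (QCD), crux `TipPricing : TipNoBinding → WegnerEstimate → WindowExtinction`.
Refuter file (cdisprove seat): sorry-free, no positive route-item conclusion.  Builds on the sibling
seat's `ExtinctionBuildsQCD/Negative/WithoutTightCollapse.lean` (clause definitions `Extinct`, `Tight`,
`SDHyp`, `SDWithoutTight`; the junk witness `sdWithoutTight_canonicalAF`: the degenerate tree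
regularisation `canonicalAF`, `m_crit ≡ 0`, satisfies EXTINCT with integrand `≡ 0` on every torus).

* `not_tipPricing_iff` — `¬ TipPricing ↔ TipNoBinding ∧ WegnerEstimate ∧ ¬ WindowExtinction`: a kill of
  this crux needs PROOFS of both open hypotheses (items 8965, 8966) and a refutation of the rank-2 crux
  `WindowExtinction` (item 8964); short of that the implication is exactly as hard as its consequent.
* `tipPricing_iff_sd` — the consequent unbundled into `SD(N_f) = ∃ reg …, EXTINCT ∧ TIGHT`.
* `tipPricingWithoutTight_trivial` — with TIGHT deleted the crux is a theorem using NEITHER hypothesis;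
  `tipPricing_collapse_schema` — the same for TIGHT replaced by ANY side condition met by `canonicalAF`
  (e.g. `m_crit(k) ∈ [−8,0]`, `m_crit → 0`, `|m_crit(k)| ≤ C g₀(k)²`).  So every gram of content of
  `TipPricing` is in producing ONE `m_crit(k)` that is simultaneously EXTINCT and TIGHT; the pricing
  of deep/window defects (the card's mechanism) enters only through that coupling, and the
  hypotheses `TipNoBinding` (a statement about a `wilsonMeasure`-null set of fields) and
  `WegnerEstimate` (quenched, `m₀ ∈ [−1,0]`) cannot be dropped-and-tested formally.
-/

namespace Summit.QuantumFields.QCD.Theorems.TipPricing.Negative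

open Summit.QuantumFields.QCD.Theses.SpectralDefectExtinction
open Summit.QuantumFields.QCD.Theorems.ExtinctionBuildsQCD.Negative
open Literature.MathematicalPhysics.QuantumFieldTheory

/-- `¬ TipPricing` is exactly "both hypotheses hold and the consequent fails". -/
theorem not_tipPricing_iff :
    ¬ TipPricing ↔ (TipNoBinding ∧ WegnerEstimate ∧ ¬ WindowExtinction) := by
  unfold TipPricing; tauto

-- buildfix 2026-08-19 (maintenance): `tipPricing_iff_sd : TipPricing ↔ (… → SDHyp Nf)` REMOVED — it
-- unfolded the pre-rev-9 consequent `WindowExtinction = ∀ N_f ∈ {2,3}, SD(N_f)` by `Iff.rfl`; route rev 9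
-- (2026-08-17) restated `WindowExtinction` to SD⁺ (volume cap, branch clause, extensive TIGHT), strictly
-- stronger than `SDHyp`, so the equivalence is neither definitional nor provable. Unreferenced elsewhere.

/-- Deleting TIGHT from the consequent weakens the crux (sanity: the deletion is faithful); the
weakened crux is `TipNoBinding → WegnerEstimate → ∀ N_f ∈ {2,3}, SDWithoutTight N_f`. -/
theorem tipPricingWithoutTight_of_tipPricing (h : TipPricing) :
    TipNoBinding → WegnerEstimate → ∀ Nf : ℕ, (Nf = 2 ∨ Nf = 3) → SDWithoutTight Nf := by
  -- buildfix 2026-08-19: the consequent is now SD⁺ (route rev 9); drop the volume cap, the branch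
  -- clause and TIGHT⁺ — EXTINCT is textually unchanged.
  intro hT hW Nf hNf
  obtain ⟨reg, h1, h2, -, -, M₀, hM₀, c, hc, h⟩ := h hT hW Nf hNf
  exact ⟨reg, h1, h2, M₀, hM₀, c, hc, fun m hm => (h m hm).1⟩

/-- **LOAD-BEARING: with TIGHT deleted from its consequent the crux is trivially true, and neither
hypothesis is used.** -/
theorem tipPricingWithoutTight_trivial :
    TipNoBinding → WegnerEstimate → ∀ Nf : ℕ, (Nf = 2 ∨ Nf = 3) → SDWithoutTight Nf :=
  fun _ _ Nf _ => sdWithoutTight_canonicalAF Nf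

/-- **Collapse schema.**  Replacing TIGHT by ANY side condition `P` on the regularisation that the
degenerate witness `canonicalAF` satisfies still gives a trivially true implication (hypotheses
unused): only a clause with INDEX content can make `TipPricing` contentful. -/
theorem tipPricing_collapse_schema (P : ∀ Nf : ℕ, QCDRegularisation Nf → Prop)
    (hP : ∀ Nf, P Nf (QCDRegularisation.canonicalAF Nf)) :
    TipNoBinding → WegnerEstimate → ∀ Nf : ℕ, (Nf = 2 ∨ Nf = 3) →
      ∃ reg : QCDRegularisation Nf, P Nf reg ∧ reg.HasMassScaling ∧
        (reg.scheme 0 0 0).HasAsymptoticScaling ∧ ∃ M₀ : ℝ, 0 ≤ M₀ ∧ ∃ c : ℝ, 0 < c ∧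
          ∀ m : Fin Nf → ℝ, (∀ f, M₀ < m f) → Extinct Nf reg c m :=
  fun _ _ Nf _ =>
    ⟨QCDRegularisation.canonicalAF Nf, hP Nf, QCDRegularisation.canonicalAF_hasMassScaling,
      QCDScheme.zeroAF_hasAsymptoticScaling, 0, le_rfl, 1, one_pos,
      fun m hm => extinct_of_mcrit_nonneg _ (fun _ => le_rfl) le_rfl m hm⟩

/-- Instance: pinning the line into `[−8, 0]` (which TIGHT does force) is no substitute for TIGHT. -/
theorem tipPricing_with_line_in_hole_trivial :
    TipNoBinding → WegnerEstimate → ∀ Nf : ℕ, (Nf = 2 ∨ Nf = 3) →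
      ∃ reg : QCDRegularisation Nf, (∀ k, -8 ≤ reg.mcrit k ∧ reg.mcrit k ≤ 0) ∧ reg.HasMassScaling ∧
        (reg.scheme 0 0 0).HasAsymptoticScaling ∧ ∃ M₀ : ℝ, 0 ≤ M₀ ∧ ∃ c : ℝ, 0 < c ∧
          ∀ m : Fin Nf → ℝ, (∀ f, M₀ < m f) → Extinct Nf reg c m :=
  tipPricing_collapse_schema (fun _ reg => ∀ k, -8 ≤ reg.mcrit k ∧ reg.mcrit k ≤ 0)
    fun _ _ => ⟨by norm_num [QCDRegularisation.canonicalAF], le_rfl⟩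

end Summit.QuantumFields.QCD.Theorems.TipPricing.Negative
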